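import Summits.CriticalPhenomena.Ising3DConformalLimit.Theses.FKParityRobustness
import Summits.CriticalPhenomena.Ising3DConformalLimit.Theorems.IndependentStrandsJoin.Negative.GraphUniform
import Summits.CriticalPhenomena.Ising3DConformalLimit.Theorems.FKParityRobustnessIndependentStrandsJoinStubUnionShadowIdentity
import Summits.CriticalPhenomena.Ising3DConformalLimit.Theorems.FKParityRobustnessIndependentStrandsJoinStubShadowGivesCrux
import Summits.CriticalPhenomena.Ising3DConformalLimit.Theorems.FKParityRobustnessIndependentStrandsJoinStubShadowConverse
import HarnessLib
import HarnessLib.Audit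

/-!
# Skeleton — crux `IndependentStrandsJoin` (stmt-CriticalPhenomena-14625), line `union-shadow-exact`
# (the exact union-shadow identity of Card `Cruxes/IndependentStrandsJoin/Ideas/union-shadow-exact.md`,
#  sharpened by the crux-triage panel r1: no `LocalAttach`/XOR one-point route; the open shadow content
#  stated ONCE, through the site-deficit floor shared with Card `fat-shadow-response`)

Route `FKParityRobustness`, sub-problem `Ising3DConformalLimit`.  Crux planner
`planner-cruxplan-stmt-CriticalPhenomena-14625-union-shadow-exact-0` (2026-08-16).

ADOPTED by line lead `prover-line-stmt-CriticalPhenomena-14625-1` (2026-08-16T18:10Z) after the line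
`cross-fattening-decoupling` died at `stub_soupAttach` (`Lines/cross-fattening-decoupling-dead.md`: crossed ONE-soup
clusters are thin — one-arm exponent ≈ 1.27 — while TWO relaying soups, as in this line's hole `C⁺`, are in the
double-current class ≈ 1.04; kit j017990).  Stubs 1–2 are LANDED by the lead (`Theorems.stub_unionShadowIdentity`
p104345 over `Theorems.stub_unionShadowFibre` p102308; `Theorems.stub_shadowGivesCrux` p103379), together with the
CONVERSE `Theorems.stub_shadowConverse` (p103991: crux ⇒ UnionShadowDeficit, same constant — so this line's content
beyond its two dictionary stubs is crux-EQUIVALENT, and stubs 3–6 are a decomposition of it) and the switching-exact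
upper partner of stub 3, `Theorems.stub_unionAttachUpper` (p105861).  Open: stubs 3–6.

NOTATION.  Finite graph `G`, `t = tanh β`, `Z^B = loopO1PartitionFunction G t B = Σ_{F ∈ 𝒯(B)} t^{|F|}`,
`𝒯(B) = tJoins G univ B`, `⟨σ_B⟩_Λ = isingCorr G Λ β 0 free B` (couplings outside `Λ` switched off;
`⟨σ_B⟩_univ = Z^B/Z^∅`).  In the box `Λ_N = {-N,…,N}³` with `a = l · tetra` and `t = t_c = tanh β_c(3)`:
two INDEPENDENT configurations `F₂ ~ ℓ^{a₂a₃}` (the strand configuration of the opposite edge) and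
`F₀ ~ ℓ^∅` (ONE vacuum soup); the UNION CLUSTER (the random hole)
`C⁺ := {v : a₂ ↝ v in F₂ ∪ F₀}` and its SHADOW on the edge `a₀a₁`,
`1 - ⟨σ_{a₀}σ_{a₁}⟩_{Λ ∖ C⁺} / ⟨σ_{a₀}σ_{a₁}⟩_Λ`; the BULK `B_l := {u ∈ Λ_N : ‖u‖_∞ ≤ 2l, u ∉ {a₀,…,a₃}}`
and the single-SITE deficit `δ_u := ⟨σ_{a₀}σ_{a₁}⟩_Λ - ⟨σ_{a₀}σ_{a₁}⟩_{Λ ∖ {u}} ≥ 0` (GKS II).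

THE LINE (six registered stubs; `sorry` only inside them):

1. `stub_unionShadowIdentity` — EXACT, every finite graph, `β ≥ 0`, `a` injective (loop form of
   Aizenman–Duminil-Copin 2021 App. Lemma 8.1 = arXiv:1912.07973 Lemma A.1; verified by exact enumeration by
   the ideator and both triagers):
   `Σ_{F₁ ∈ 𝒯(01)} Σ_{F₂ ∈ 𝒯(23)} 1[a₀ ↮ a₂ in F₁ ∪ F₂] t^{|F₁|+|F₂|}
      = Σ_{F₂ ∈ 𝒯(23)} Σ_{F₀ ∈ 𝒯(∅)} 1[a₀, a₁ ∉ C⁺] t^{|F₂|+|F₀|} ⟨σ_{a₀}σ_{a₁}⟩_{G ∖ C⁺}`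
   (decompose `F₁ = F₁[C⁺] ⊔ F₁[G - V(C⁺)]`; the outside part is a free `𝒯(01)`- resp. `𝒯(∅)`-configuration
   of `G - V(C⁺)`).  Dividing by `Z^{01}Z^{23}`: `1 - q = E^{ℓ^{23} ⊗ ℓ^∅}[1[a₀,a₁ ∉ C⁺] ⟨σσ⟩_{Λ∖C⁺}/⟨σσ⟩_Λ]`,
   so the crux is EQUIVALENT to a uniform expected shadow of the hole `C⁺` (no depletion inequality, no loss).
2. `stub_shadowGivesCrux` — (1) + `UnionShadowDeficit` (expected shadow `≥ c`, cleared denominators) ⟹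
   the crux body, constant `c`, same `N₀` (`Z^{01}Z^{23} = jointSum + avoidSum`, `⟨σ₀σ₁⟩_Λ = Z^{01}/Z^∅`).
3. `stub_unionAttach` — ONE-POINT LOWER BOUND of the hole (box, `t_c`, `l`-uniform, bulk `u`):
   `ℓ^{23} ⊗ ℓ^∅[u ∈ C⁺] ≥ c₀ · τ(a₂u)τ(ua₃)/τ(a₂a₃)`, i.e. `c₀ Z^{a₂u} Z^{ua₃} ≤ Σ 1[a₂ ↝ u] t^{…}`:
   the odd-parts-plus-one-soup cluster keeps a constant fraction of the double-current cluster's exact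
   one-point function (the matching UPPER bound `≤ τ τ/τ` holds on every graph by the odd-part coupling
   and the switching lemma — a support lemma, not a stub).  Replaces the card's `LocalAttach` (triage r1-1:
   the common-endpoint XOR cascade predicts `LocalAttach` false; the union event has no XOR cancellation).
4. `stub_bulkResponseFloor` — THE EXPOSED `d = 3` INPUT, a deterministic first-moment correlation
   inequality (the bulk form of Card `fat-shadow-response`'s `ResponseFloor`, stated once for both shadow
   lines): `Σ_{u ∈ B_l} ⟨σ_{a₂}σ_u⟩⟨σ_uσ_{a₃}⟩ · δ_u ≥ c₁ · ⟨σ_{a₂}σ_{a₃}⟩⟨σ_{a₀}σ_{a₁}⟩`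
   (predicted to DIVERGE like `l^{(2-η)-Δ_ε} = l^{0.55}`; asked only `≥ c₁`).
5. `stub_massConcentration` — (3) + (4) give the first moment `E[X(C⁺)] ≥ c₀c₁` of the additive deficit
   mass `X(S) := Σ_{u ∈ S ∩ B_l} δ_u/⟨σ_{a₀}σ_{a₁}⟩`; the stub upgrades it to `P[X(C⁺) ≥ ε] ≥ p`
   (`MassPositive`): upper-tail control of `X(C⁺)` at its true scale (two-point tree bound for `C⁺ ⊆` the
   double-current cluster, AF86 Lemma 5.5 upper bound on `δ_u`, regular scales).
6. `stub_shadowCompounding` — `MassPositive → UnionShadowDeficit`: a hole that carries additive deficit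
   mass `≥ ε` with probability `≥ p` AND spans the edge `a₂a₃` casts expected shadow `≥ c` (screening
   control; HARDEST — for arbitrary localised site sets the deterministic analogue is false, so the spread of
   `C⁺ ∋ a₂, a₃` at scale `l` must be used).

`IndependentStrandsJoin_of` assumes exactly the six registered stubs (name-keyed `Registered.stub_*`) and
concludes the crux BY NAME: `h2 h1 (h6 (h5 h3 h4))`.

DISPROOF / NEGATIVE LEMMAS honoured (Cruxes/IndependentStrandsJoin/Disproof.lean cycle 1; landed
`Theorems/IndependentStrandsJoin/Negative/{GraphUniform,LoadBearing}.lean`; the first is imported below): every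
constant-bearing stub (3–6) is stated on the boxes `Λ_N ⊂ ℤ³` at `t_c` only (`not_graphUniformStrandsJoin`:
no graph-uniform constant; stub 3 is indeed FALSE graph-uniformly — on a tree `C⁺` is the `a₂a₃` path); all
constants are `l`-uniform with `∃ c` before `∀ l` (§ A: the per-scale crux is true, `1 ≤ l` is not
load-bearing); stubs 1–2 are graph-uniform IDENTITIES/glue and claimed only as such.

Stub statements are INLINED in the registered `stub_*` theorems (no new tree definitions): stubs land as
theorem-only `--supports stmt-CriticalPhenomena-14625` files under `Theorems/`.
-/

noncomputable section

open Finset SimpleGraph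
open Literature.Probability.LatticeModels
open Summit.CriticalPhenomena.Ising3DConformalLimit.Theses.FKParityRobustness

namespace Summit.CriticalPhenomena.Ising3DConformalLimit.Cruxes.IndependentStrandsJoin.UnionShadowExact

open scoped Classical BigOperators

-- GLUE (lead -1): the LANDED stub files are elaborated without the `Theses` import and carry classical `Decidable`
-- instances in their indicators / filters, while this skeleton carries the decidable-`Reachable` instances; the statements
-- agree propositionally.  The recurring tactic block below ("peel & convert") closes a goal `P ↔ Q` between two crux-shaped
-- statements by peeling the binders on both sides and `convert`ing the quantifier-free bodies (Decidable instances are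
-- subsingletons).

/-! ### The stub STATEMENTS (named `Prop`s, used only by the composition; the registered `stub_*`
theorems below restate them verbatim, fully inlined) -/

/-- Statement of Stub 1: the UNION-SHADOW IDENTITY (exact; loop-O(1) form of ADC2021 App. Lemma 8.1), on every
finite graph, `β ≥ 0`, `a` injective; LHS in the crux's own shape (avoidance instead of joining). -/
def UnionShadowIdentity : Prop :=
  ∀ (V : Type) [Fintype V] [DecidableEq V] (G : SimpleGraph V) [DecidableRel G.Adj] (β : ℝ),
    0 ≤ β → ∀ a : Fin 4 → V, Function.Injective a →
    (∑ F₁ ∈ tJoins G Set.univ {a 0, a 1}, ∑ F₂ ∈ tJoins G Set.univ {a 2, a 3},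
        if (SimpleGraph.fromEdgeSet ((↑F₁ : Set (Sym2 V)) ∪ ↑F₂)).Reachable (a 0) (a 2) then (0 : ℝ)
        else Real.tanh β ^ (F₁.card + F₂.card))
      =
    ∑ F₂ ∈ tJoins G Set.univ {a 2, a 3}, ∑ F₀ ∈ tJoins G Set.univ (∅ : Finset V),
        if ¬ (SimpleGraph.fromEdgeSet ((↑F₂ : Set (Sym2 V)) ∪ ↑F₀)).Reachable (a 2) (a 0) ∧
           ¬ (SimpleGraph.fromEdgeSet ((↑F₂ : Set (Sym2 V)) ∪ ↑F₀)).Reachable (a 2) (a 1)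
        then Real.tanh β ^ (F₂.card + F₀.card) *
             isingCorr G (Finset.univ.filter (fun v : V =>
               ¬ (SimpleGraph.fromEdgeSet ((↑F₂ : Set (Sym2 V)) ∪ ↑F₀)).Reachable (a 2) v)) β 0 .free {a 0, a 1}
        else 0

/-- Statement `UnionShadowDeficit` (the card's `UnionShadow`, cleared denominators; EQUIVALENT to the crux
by Stub 1): averaged over `F₂ ~ ℓ^{a₂a₃}` and one independent vacuum soup `F₀ ~ ℓ^∅` in the critical free box,
deleting the union cluster `C⁺` of `a₂` cuts `⟨σ_{a₀}σ_{a₁}⟩` by a uniform factor: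
`Σ_{F₂,F₀} 1[a₀,a₁ ∉ C⁺] t^{|F₂|+|F₀|} ⟨σ_{a₀}σ_{a₁}⟩_{Λ∖C⁺} ≤ (1 - c) · Z^{23} Z^∅ ⟨σ_{a₀}σ_{a₁}⟩_Λ`. -/
def UnionShadowDeficit : Prop :=
  ∃ c : ℝ, 0 < c ∧ ∀ l : ℕ, 1 ≤ l → ∃ N₀ : ℕ, ∀ N : ℕ, N₀ ≤ N → ∀ a : Fin 4 → ↥(box 3 N),
    (∀ i, ((a i : Site 3)) = (l : ℤ) •
      (![![-1, -1, -1], ![1, 1, -1], ![1, -1, 1], ![-1, 1, 1]] : Fin 4 → Site 3) i) →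
    (∑ F₂ ∈ tJoins ((zdGraph 3).comap (Subtype.val : ↥(box 3 N) → Site 3)) Set.univ {a 2, a 3},
      ∑ F₀ ∈ tJoins ((zdGraph 3).comap (Subtype.val : ↥(box 3 N) → Site 3)) Set.univ (∅ : Finset ↥(box 3 N)),
        if ¬ (SimpleGraph.fromEdgeSet ((↑F₂ : Set (Sym2 ↥(box 3 N))) ∪ ↑F₀)).Reachable (a 2) (a 0) ∧
           ¬ (SimpleGraph.fromEdgeSet ((↑F₂ : Set (Sym2 ↥(box 3 N))) ∪ ↑F₀)).Reachable (a 2) (a 1)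
        then Real.tanh (criticalBeta 3) ^ (F₂.card + F₀.card) *
             isingCorr ((zdGraph 3).comap (Subtype.val : ↥(box 3 N) → Site 3))
               (Finset.univ.filter (fun v : ↥(box 3 N) =>
                 ¬ (SimpleGraph.fromEdgeSet ((↑F₂ : Set (Sym2 ↥(box 3 N))) ∪ ↑F₀)).Reachable (a 2) v))
               (criticalBeta 3) 0 .free {a 0, a 1}
        else 0)
      ≤ (1 - c) * (loopO1PartitionFunction ((zdGraph 3).comap (Subtype.val : ↥(box 3 N) → Site 3))
              (Real.tanh (criticalBeta 3)) {a 2, a 3} *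
            loopO1PartitionFunction ((zdGraph 3).comap (Subtype.val : ↥(box 3 N) → Site 3))
              (Real.tanh (criticalBeta 3)) ∅ *
            isingCorr ((zdGraph 3).comap (Subtype.val : ↥(box 3 N) → Site 3)) Finset.univ
              (criticalBeta 3) 0 .free {a 0, a 1})

/-- The crux's statement, verbatim (the body of the route decl `IndependentStrandsJoin`). -/
def CruxBody : Prop :=
  let tetra : Fin 4 → Literature.Probability.LatticeModels.Site 3 := ![![-1, -1, -1], ![1, 1, -1], ![1, -1, 1], ![-1, 1, 1]]; ∃ c : ℝ, 0 < c ∧ ∀ l : ℕ, 1 ≤ l → ∃ N₀ : ℕ, ∀ N : ℕ, N₀ ≤ N → ∀ a : Fin 4 → ↥(Literature.Probability.LatticeModels.box 3 N), (∀ i, ((a i : Literature.Probability.LatticeModels.Site 3)) = (l : ℤ) • tetra i) → (let G := ((Literature.Probability.LatticeModels.zdGraph 3).comap (Subtype.val : ↥(Literature.Probability.LatticeModels.box 3 N) → Literature.Probability.LatticeModels.Site 3)); let t : ℝ := Real.tanh (Literature.Probability.LatticeModels.criticalBeta 3); c * Literature.Probability.LatticeModels.loopO1PartitionFunction G t {a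 0, a 1} * Literature.Probability.LatticeModels.loopO1PartitionFunction G t {a 2, a 3} ≤ ∑ F₁ ∈ Literature.Probability.LatticeModels.tJoins G Set.univ {a 0, a 1}, ∑ F₂ ∈ Literature.Probability.LatticeModels.tJoins G Set.univ {a 2, a 3}, if (SimpleGraph.fromEdgeSet ((↑F₁ : Set (Sym2 ↥(Literature.Probability.LatticeModels.box 3 N))) ∪ ↑F₂)).Reachable (a 0) (a 2) then t ^ (F₁.card + F₂.card) else 0)

/-- Statement of Stub 2 (glue): the identity and the expected-shadow bound give the crux body. -/
def ShadowGivesCrux : Prop :=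
  UnionShadowIdentity → UnionShadowDeficit → CruxBody

/-- Statement of Stub 3: ONE-POINT LOWER BOUND for the union cluster (box, critical, `l`-uniform, bulk
`u` off the sources): `c₀ · Z^{a₂u} Z^{ua₃} ≤ Σ_{F₂ ∈ 𝒯(23)} Σ_{F₀ ∈ 𝒯(∅)} 1[a₂ ↝ u in F₂ ∪ F₀] t^{|F₂|+|F₀|}`,
i.e. `ℓ^{23} ⊗ ℓ^∅[u ∈ C⁺] ≥ c₀ · ⟨σ_{a₂}σ_u⟩⟨σ_uσ_{a₃}⟩/⟨σ_{a₂}σ_{a₃}⟩`. -/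
def UnionAttach : Prop :=
  ∃ c₀ : ℝ, 0 < c₀ ∧ ∀ l : ℕ, 1 ≤ l → ∃ N₀ : ℕ, ∀ N : ℕ, N₀ ≤ N → ∀ a : Fin 4 → ↥(box 3 N),
    (∀ i, ((a i : Site 3)) = (l : ℤ) •
      (![![-1, -1, -1], ![1, 1, -1], ![1, -1, 1], ![-1, 1, 1]] : Fin 4 → Site 3) i) →
    ∀ u : ↥(box 3 N), (∀ i, |(u : Site 3) i| ≤ 2 * (l : ℤ)) → u ∉ Finset.univ.image a →
    c₀ * loopO1PartitionFunction ((zdGraph 3).comap (Subtype.val : ↥(box 3 N) → Site 3))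
          (Real.tanh (criticalBeta 3)) {a 2, u} *
        loopO1PartitionFunction ((zdGraph 3).comap (Subtype.val : ↥(box 3 N) → Site 3))
          (Real.tanh (criticalBeta 3)) {u, a 3}
      ≤ ∑ F₂ ∈ tJoins ((zdGraph 3).comap (Subtype.val : ↥(box 3 N) → Site 3)) Set.univ {a 2, a 3},
          ∑ F₀ ∈ tJoins ((zdGraph 3).comap (Subtype.val : ↥(box 3 N) → Site 3)) Set.univ (∅ : Finset ↥(box 3 N)),
            if (SimpleGraph.fromEdgeSet ((↑F₂ : Set (Sym2 ↥(box 3 N))) ∪ ↑F₀)).Reachable (a 2) u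
            then Real.tanh (criticalBeta 3) ^ (F₂.card + F₀.card) else 0

/-- Statement of Stub 4: the BULK RESPONSE FLOOR (deterministic, critical box, `l`-uniform; the bulk form of
`fat-shadow-response`'s `ResponseFloor`): the double-current-profile-weighted sum of single-site deficits of
`⟨σ_{a₀}σ_{a₁}⟩` over the bulk is at least a constant times `⟨σ_{a₂}σ_{a₃}⟩⟨σ_{a₀}σ_{a₁}⟩`. -/
def BulkResponseFloor : Prop :=
  ∃ c₁ : ℝ, 0 < c₁ ∧ ∀ l : ℕ, 1 ≤ l → ∃ N₀ : ℕ, ∀ N : ℕ, N₀ ≤ N → ∀ a : Fin 4 → ↥(box 3 N),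
    (∀ i, ((a i : Site 3)) = (l : ℤ) •
      (![![-1, -1, -1], ![1, 1, -1], ![1, -1, 1], ![-1, 1, 1]] : Fin 4 → Site 3) i) →
    c₁ * isingCorr ((zdGraph 3).comap (Subtype.val : ↥(box 3 N) → Site 3)) Finset.univ
          (criticalBeta 3) 0 .free {a 2, a 3} *
        isingCorr ((zdGraph 3).comap (Subtype.val : ↥(box 3 N) → Site 3)) Finset.univ
          (criticalBeta 3) 0 .free {a 0, a 1}
      ≤ ∑ u ∈ (Finset.univ : Finset ↥(box 3 N)).filter
            (fun u : ↥(box 3 N) => (∀ i, |(u : Site 3) i| ≤ 2 * (l : ℤ)) ∧ u ∉ Finset.univ.image a),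
          isingCorr ((zdGraph 3).comap (Subtype.val : ↥(box 3 N) → Site 3)) Finset.univ
              (criticalBeta 3) 0 .free {a 2, u} *
            isingCorr ((zdGraph 3).comap (Subtype.val : ↥(box 3 N) → Site 3)) Finset.univ
              (criticalBeta 3) 0 .free {u, a 3} *
            (isingCorr ((zdGraph 3).comap (Subtype.val : ↥(box 3 N) → Site 3)) Finset.univ
                (criticalBeta 3) 0 .free {a 0, a 1} -
              isingCorr ((zdGraph 3).comap (Subtype.val : ↥(box 3 N) → Site 3)) (Finset.univ.erase u)
                (criticalBeta 3) 0 .free {a 0, a 1})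

/-- Statement `MassPositive`: with probability `≥ p` under `ℓ^{23} ⊗ ℓ^∅` the union cluster carries
additive deficit mass `X(C⁺) = Σ_{u ∈ C⁺ ∩ B_l} δ_u ≥ ε · ⟨σ_{a₀}σ_{a₁}⟩_Λ` (cleared denominators). -/
def MassPositive : Prop :=
  ∃ ε : ℝ, 0 < ε ∧ ∃ p : ℝ, 0 < p ∧ ∀ l : ℕ, 1 ≤ l → ∃ N₀ : ℕ, ∀ N : ℕ, N₀ ≤ N →
    ∀ a : Fin 4 → ↥(box 3 N),
    (∀ i, ((a i : Site 3)) = (l : ℤ) •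
      (![![-1, -1, -1], ![1, 1, -1], ![1, -1, 1], ![-1, 1, 1]] : Fin 4 → Site 3) i) →
    p * loopO1PartitionFunction ((zdGraph 3).comap (Subtype.val : ↥(box 3 N) → Site 3))
          (Real.tanh (criticalBeta 3)) {a 2, a 3} *
        loopO1PartitionFunction ((zdGraph 3).comap (Subtype.val : ↥(box 3 N) → Site 3))
          (Real.tanh (criticalBeta 3)) ∅
      ≤ ∑ F₂ ∈ tJoins ((zdGraph 3).comap (Subtype.val : ↥(box 3 N) → Site 3)) Set.univ {a 2, a 3},
          ∑ F₀ ∈ tJoins ((zdGraph 3).comap (Subtype.val : ↥(box 3 N) → Site 3)) Set.univ (∅ : Finset ↥(box 3 N)),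
            if ε * isingCorr ((zdGraph 3).comap (Subtype.val : ↥(box 3 N) → Site 3)) Finset.univ
                  (criticalBeta 3) 0 .free {a 0, a 1}
                ≤ ∑ u ∈ (Finset.univ : Finset ↥(box 3 N)).filter
                    (fun u : ↥(box 3 N) => (∀ i, |(u : Site 3) i| ≤ 2 * (l : ℤ)) ∧ u ∉ Finset.univ.image a ∧
                      (SimpleGraph.fromEdgeSet ((↑F₂ : Set (Sym2 ↥(box 3 N))) ∪ ↑F₀)).Reachable (a 2) u),
                    (isingCorr ((zdGraph 3).comap (Subtype.val : ↥(box 3 N) → Site 3)) Finset.univ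
                        (criticalBeta 3) 0 .free {a 0, a 1} -
                      isingCorr ((zdGraph 3).comap (Subtype.val : ↥(box 3 N) → Site 3)) (Finset.univ.erase u)
                        (criticalBeta 3) 0 .free {a 0, a 1})
            then Real.tanh (criticalBeta 3) ^ (F₂.card + F₀.card) else 0

/-- Statement of Stub 5 (concentration): first-moment inputs ⟹ positive mass with positive probability. -/
def MassConcentration : Prop :=
  UnionAttach → BulkResponseFloor → MassPositive

/-- Statement of Stub 6 (compounding, the hardest): positive additive deficit mass of the spanning hole
`C⁺` ⟹ uniform expected shadow. -/
def ShadowCompounding : Prop :=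
  MassPositive → UnionShadowDeficit

/-! ### Name-keyed aliases of the registered stubs (the hypotheses of the composition) -/
namespace Registered

/-- Alias of `UnionShadowIdentity` keyed by the registered stub name. -/
abbrev stub_unionShadowIdentity : Prop := UnionShadowIdentity
/-- Alias of `ShadowGivesCrux` keyed by the registered stub name. -/
abbrev stub_shadowGivesCrux : Prop := ShadowGivesCrux
/-- Alias of `UnionAttach` keyed by the registered stub name. -/
abbrev stub_unionAttach : Prop := UnionAttach
/-- Alias of `BulkResponseFloor` keyed by the registered stub name. -/
abbrev stub_bulkResponseFloor : Prop := BulkResponseFloor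
/-- Alias of `MassConcentration` keyed by the registered stub name. -/
abbrev stub_massConcentration : Prop := MassConcentration
/-- Alias of `ShadowCompounding` keyed by the registered stub name. -/
abbrev stub_shadowCompounding : Prop := ShadowCompounding

end Registered

/-! ### The composition: the six registered stubs imply the crux, BY NAME -/

/-- The planner's six-hypothesis composition (conclusion `CruxBody` ≡ the crux): identity, glue, one-point attachment,
bulk response floor, concentration, compounding. -/
theorem IndependentStrandsJoin_of_six (h1 : Registered.stub_unionShadowIdentity)
    (h2 : Registered.stub_shadowGivesCrux) (h3 : Registered.stub_unionAttach)
    (h4 : Registered.stub_bulkResponseFloor) (h5 : Registered.stub_massConcentration)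
    (h6 : Registered.stub_shadowCompounding) : CruxBody :=
  h2 h1 (h6 (h5 h3 h4))

/-! ### The registered stubs (`sorry` lives ONLY here); statements verbatim, fully inlined -/

/-- **Stub 1 (union-shadow identity; exact; LANDED by lead -1 as `Theorems.stub_unionShadowIdentity`, p104345 + Fibre helper p102308).**  For `F₂ ∈ 𝒯(a₂a₃)` and either an
independent `F₁ ∈ 𝒯(a₀a₁)` or an independent vacuum configuration `F₀ ∈ 𝒯(∅)`, let `C` be the cluster of
`a₂` in the union.  Every edge of the second configuration with an endpoint in `V(C)` lies inside `C`, so the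
second configuration splits as (even subgraph inside `V(C)`) ⊔ (a `T`-join of `G - V(C)` with the SAME
sources, provided the sources avoid `V(C)`); the admissible inside parts are the same for sources `{a₀,a₁}`
and `∅`, and summing the outside parts gives `Z^{01}(G - V(C))`, resp. `Z^∅(G - V(C))`, whose ratio is
`⟨σ_{a₀}σ_{a₁}⟩^free_{G - V(C)}` (`isingCorr_free_eq_hteSum_div` on the induced sub-volume).  On the left,
`a₀ ↮ a₂` forces `a₁ ∉ V(C)` as well (`a₀ ~_{F₁} a₁`, `reachable_of_mem_tJoins_pair`).  Same fibre technique as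
the landed pair-split identity (★) `Theorems/FKParityRobustnessIndependentStrandsJoinStubPairSplit(Aux).lean`. -/
theorem stub_unionShadowIdentity :
    ∀ (V : Type) [Fintype V] [DecidableEq V] (G : SimpleGraph V) [DecidableRel G.Adj] (β : ℝ),
      0 ≤ β → ∀ a : Fin 4 → V, Function.Injective a →
      (∑ F₁ ∈ tJoins G Set.univ {a 0, a 1}, ∑ F₂ ∈ tJoins G Set.univ {a 2, a 3},
          if (SimpleGraph.fromEdgeSet ((↑F₁ : Set (Sym2 V)) ∪ ↑F₂)).Reachable (a 0) (a 2) then (0 : ℝ)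
          else Real.tanh β ^ (F₁.card + F₂.card))
        =
      ∑ F₂ ∈ tJoins G Set.univ {a 2, a 3}, ∑ F₀ ∈ tJoins G Set.univ (∅ : Finset V),
          if ¬ (SimpleGraph.fromEdgeSet ((↑F₂ : Set (Sym2 V)) ∪ ↑F₀)).Reachable (a 2) (a 0) ∧
             ¬ (SimpleGraph.fromEdgeSet ((↑F₂ : Set (Sym2 V)) ∪ ↑F₀)).Reachable (a 2) (a 1)
          then Real.tanh β ^ (F₂.card + F₀.card) *
               isingCorr G (Finset.univ.filter (fun v : V =>
                 ¬ (SimpleGraph.fromEdgeSet ((↑F₂ : Set (Sym2 V)) ∪ ↑F₀)).Reachable (a 2) v)) β 0 .free {a 0, a 1}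
          else 0 := by
  -- the LANDED theorem, elaborated without the `Theses` import, carries classical `Decidable` instances in its
  -- indicators/filters; `convert` bridges them (all `Decidable` instances are subsingletons)
  intro V _ _ G _ β hβ a ha
  convert Summit.CriticalPhenomena.Ising3DConformalLimit.Theorems.stub_unionShadowIdentity V G β hβ a ha

/-- **Stub 2 (shadow gives crux; glue; LANDED by lead -1 as `Theorems.stub_shadowGivesCrux`, p103379; converse `Theorems.stub_shadowConverse`, p103991).**  From the identity (Stub 1) and the expected
shadow bound `UnionShadowDeficit` (constant `c`): in the box, with `a = l · tetra` injective for `l ≥ 1`,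
`avoidSum = [RHS of Stub 1] ≤ (1 - c) Z^{23} Z^∅ ⟨σ_{a₀}σ_{a₁}⟩_Λ = (1 - c) Z^{23} Z^{01}` (HT expansion
`⟨σ_{a₀}σ_{a₁}⟩^free_Λ = Z^{01}/Z^∅`, `isingCorr_free_eq_hteSum_div` + `hteSum_univ_eq_loopO1PartitionFunction`,
`Z^∅ > 0`), while `Z^{01} Z^{23} = jointSum + avoidSum` (`Finset.sum_mul_sum`, `pow_add`, `ite` split); hence
`jointSum ≥ c · Z^{01} Z^{23}` — the crux body with the same `c` and `N₀`. -/
theorem stub_shadowGivesCrux :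
    (∀ (V : Type) [Fintype V] [DecidableEq V] (G : SimpleGraph V) [DecidableRel G.Adj] (β : ℝ),
      0 ≤ β → ∀ a : Fin 4 → V, Function.Injective a →
      (∑ F₁ ∈ tJoins G Set.univ {a 0, a 1}, ∑ F₂ ∈ tJoins G Set.univ {a 2, a 3},
          if (SimpleGraph.fromEdgeSet ((↑F₁ : Set (Sym2 V)) ∪ ↑F₂)).Reachable (a 0) (a 2) then (0 : ℝ)
          else Real.tanh β ^ (F₁.card + F₂.card))
        =
      ∑ F₂ ∈ tJoins G Set.univ {a 2, a 3}, ∑ F₀ ∈ tJoins G Set.univ (∅ : Finset V),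
          if ¬ (SimpleGraph.fromEdgeSet ((↑F₂ : Set (Sym2 V)) ∪ ↑F₀)).Reachable (a 2) (a 0) ∧
             ¬ (SimpleGraph.fromEdgeSet ((↑F₂ : Set (Sym2 V)) ∪ ↑F₀)).Reachable (a 2) (a 1)
          then Real.tanh β ^ (F₂.card + F₀.card) *
               isingCorr G (Finset.univ.filter (fun v : V =>
                 ¬ (SimpleGraph.fromEdgeSet ((↑F₂ : Set (Sym2 V)) ∪ ↑F₀)).Reachable (a 2) v)) β 0 .free {a 0, a 1}
          else 0) →
    (∃ c : ℝ, 0 < c ∧ ∀ l : ℕ, 1 ≤ l → ∃ N₀ : ℕ, ∀ N : ℕ, N₀ ≤ N → ∀ a : Fin 4 → ↥(box 3 N),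
      (∀ i, ((a i : Site 3)) = (l : ℤ) •
        (![![-1, -1, -1], ![1, 1, -1], ![1, -1, 1], ![-1, 1, 1]] : Fin 4 → Site 3) i) →
      (∑ F₂ ∈ tJoins ((zdGraph 3).comap (Subtype.val : ↥(box 3 N) → Site 3)) Set.univ {a 2, a 3},
        ∑ F₀ ∈ tJoins ((zdGraph 3).comap (Subtype.val : ↥(box 3 N) → Site 3)) Set.univ (∅ : Finset ↥(box 3 N)),
          if ¬ (SimpleGraph.fromEdgeSet ((↑F₂ : Set (Sym2 ↥(box 3 N))) ∪ ↑F₀)).Reachable (a 2) (a 0) ∧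
             ¬ (SimpleGraph.fromEdgeSet ((↑F₂ : Set (Sym2 ↥(box 3 N))) ∪ ↑F₀)).Reachable (a 2) (a 1)
          then Real.tanh (criticalBeta 3) ^ (F₂.card + F₀.card) *
               isingCorr ((zdGraph 3).comap (Subtype.val : ↥(box 3 N) → Site 3))
                 (Finset.univ.filter (fun v : ↥(box 3 N) =>
                   ¬ (SimpleGraph.fromEdgeSet ((↑F₂ : Set (Sym2 ↥(box 3 N))) ∪ ↑F₀)).Reachable (a 2) v))
                 (criticalBeta 3) 0 .free {a 0, a 1}
          else 0)
        ≤ (1 - c) * (loopO1PartitionFunction ((zdGraph 3).comap (Subtype.val : ↥(box 3 N) → Site 3))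
                (Real.tanh (criticalBeta 3)) {a 2, a 3} *
              loopO1PartitionFunction ((zdGraph 3).comap (Subtype.val : ↥(box 3 N) → Site 3))
                (Real.tanh (criticalBeta 3)) ∅ *
              isingCorr ((zdGraph 3).comap (Subtype.val : ↥(box 3 N) → Site 3)) Finset.univ
                (criticalBeta 3) 0 .free {a 0, a 1})) →
    (let tetra : Fin 4 → Literature.Probability.LatticeModels.Site 3 := ![![-1, -1, -1], ![1, 1, -1], ![1, -1, 1], ![-1, 1, 1]]; ∃ c : ℝ, 0 < c ∧ ∀ l : ℕ, 1 ≤ l → ∃ N₀ : ℕ, ∀ N : ℕ, N₀ ≤ N → ∀ a : Fin 4 → ↥(Literature.Probability.LatticeModels.box 3 N), (∀ i, ((a i : Literature.Probability.LatticeModels.Site 3)) = (l : ℤ) • tetra i) → (let G := ((Literature.Probability.LatticeModels.zdGraph 3).comap (Subtype.val : ↥(Literature.Probability.LatticeModels.box 3 N) → Literature.Probability.LatticeModels.Site 3)); let t : ℝ := Real.tanh (Literature.Probability.LatticeModels.criticalBeta 3); c * Literature.Probability.LatticeModels.loopO1PartitionFunction G t {a 0, a 1} * Literature.Probability.LatticeModels.loopO1PartitionFunction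 G t {a 2, a 3} ≤ ∑ F₁ ∈ Literature.Probability.LatticeModels.tJoins G Set.univ {a 0, a 1}, ∑ F₂ ∈ Literature.Probability.LatticeModels.tJoins G Set.univ {a 2, a 3}, if (SimpleGraph.fromEdgeSet ((↑F₁ : Set (Sym2 ↥(Literature.Probability.LatticeModels.box 3 N))) ∪ ↑F₂)).Reachable (a 0) (a 2) then t ^ (F₁.card + F₂.card) else 0)) := by
  intro hI hD
  have hI' := fun (V : Type) [Fintype V] [DecidableEq V] (G : SimpleGraph V) [DecidableRel G.Adj] (β : ℝ)
      (hβ : 0 ≤ β) (a : Fin 4 → V) (ha : Function.Injective a) =>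
    Summit.CriticalPhenomena.Ising3DConformalLimit.Theorems.stub_unionShadowIdentity V G β hβ a ha
  have h := Summit.CriticalPhenomena.Ising3DConformalLimit.Theorems.stub_shadowGivesCrux hI' (by convert hD)
  convert h
  (constructor <;> rintro ⟨c, hc, hh⟩ <;> refine ⟨c, hc, fun l hl => ?_⟩ <;> obtain ⟨N₀, hh⟩ := hh l hl <;>
      refine ⟨N₀, fun N hN a ha => ?_⟩ <;> have h2 := hh N hN a ha <;> (try dsimp only at h2 ⊢) <;> convert h2 using 8)

/-- **Stub 3 (one-point attachment of the union cluster; OPEN, M/L; box-specific by design).**  In the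
critical free box, for `a = l · tetra`, bulk `u` (`‖u‖_∞ ≤ 2l`) off the sources, uniformly in `l ≥ 1`,
`N ≥ N₀(l)`: `c₀ · Z^{a₂u} · Z^{ua₃} ≤ Σ_{F₂ ∈ 𝒯(a₂a₃)} Σ_{F₀ ∈ 𝒯(∅)} 1[a₂ ↝ u in F₂ ∪ F₀] t^{|F₂|+|F₀|}`, i.e.
`P[u ∈ C⁺] ≥ c₀ · ⟨σ_{a₂}σ_u⟩⟨σ_uσ_{a₃}⟩/⟨σ_{a₂}σ_{a₃}⟩`.  Why plausibly true: `C⁺ ⊆ 𝐂 := C_{n₁+n₂}(a₂)` under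
the odd-part coupling, `P[u ∈ 𝐂] = ττ/τ` EXACTLY (switching), and `𝐂 = C⁺ ∪` a Bernoulli(`1 - sech² β_c ≈ 0.048`)
sprinkling of even-multiplicity edges (conditional law of `n` given `odd n`); MC: ratio `0.65–0.91` on small
graphs, `A(l) = 0.75/0.83/0.72` at `l = 2,3,4` (j014058), `E|V(C⁺)| ∝ l^{1.89}` vs `2 - η = 1.96`.
Why it might fail: the `4.8 %` sprinkling could carry a POWER of `l` (then `C⁺` is thinner than `𝐂` by
`l^{-κ}` and Stubs 4–6 must be re-weighted by the true profile).  Graph-uniformly it is FALSE (trees: `C⁺` is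
the `a₂a₃` path) — consistent with `not_graphUniformStrandsJoin`. -/
theorem stub_unionAttach :
    ∃ c₀ : ℝ, 0 < c₀ ∧ ∀ l : ℕ, 1 ≤ l → ∃ N₀ : ℕ, ∀ N : ℕ, N₀ ≤ N → ∀ a : Fin 4 → ↥(box 3 N),
      (∀ i, ((a i : Site 3)) = (l : ℤ) •
        (![![-1, -1, -1], ![1, 1, -1], ![1, -1, 1], ![-1, 1, 1]] : Fin 4 → Site 3) i) →
      ∀ u : ↥(box 3 N), (∀ i, |(u : Site 3) i| ≤ 2 * (l : ℤ)) → u ∉ Finset.univ.image a →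
      c₀ * loopO1PartitionFunction ((zdGraph 3).comap (Subtype.val : ↥(box 3 N) → Site 3))
            (Real.tanh (criticalBeta 3)) {a 2, u} *
          loopO1PartitionFunction ((zdGraph 3).comap (Subtype.val : ↥(box 3 N) → Site 3))
            (Real.tanh (criticalBeta 3)) {u, a 3}
        ≤ ∑ F₂ ∈ tJoins ((zdGraph 3).comap (Subtype.val : ↥(box 3 N) → Site 3)) Set.univ {a 2, a 3},
            ∑ F₀ ∈ tJoins ((zdGraph 3).comap (Subtype.val : ↥(box 3 N) → Site 3)) Set.univ (∅ : Finset ↥(box 3 N)),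
              if (SimpleGraph.fromEdgeSet ((↑F₂ : Set (Sym2 ↥(box 3 N))) ∪ ↑F₀)).Reachable (a 2) u
              then Real.tanh (criticalBeta 3) ^ (F₂.card + F₀.card) else 0 := by
  sorry

/-- **Stub 4 (bulk response floor; OPEN — the exposed `d = 3` input, shared with `fat-shadow-response`).**
In the critical free box, uniformly in `l ≥ 1`, `N ≥ N₀(l)`:
`c₁ · ⟨σ_{a₂}σ_{a₃}⟩⟨σ_{a₀}σ_{a₁}⟩ ≤ Σ_{u ∈ B_l} ⟨σ_{a₂}σ_u⟩⟨σ_uσ_{a₃}⟩ · (⟨σ_{a₀}σ_{a₁}⟩_Λ - ⟨σ_{a₀}σ_{a₁}⟩_{Λ∖{u}})`.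
Every summand is `≥ 0` (GKS I, II), and `δ_u/⟨σ_{a₀}σ_{a₁}⟩ ≥ ℓ^{a₀a₁}[u ∈ V(K_{a₀})]` (single-site
`DepletionBound`, landed as `Theorems/FKParityRobustnessIndependentStrandsJoinStubDepletionBound.lean`), so the
sum dominates `E|𝐂(a₂) ∩ K_{a₀} ∩ B_l|`; prediction `∝ l^{(2-η)-Δ_ε} = l^{0.55} → ∞` (energy operator relevant on a
`(2-η)`-dimensional set; `Δ_ε = 1.4126`).  Why it might fail: only through `Δ_ε ≥ 2 - η` (false numerically by
`0.55`; it IS the marginal/irrelevant case in `d = 4` / `d ≥ 5`, where the stub fails as it must); rigorously no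
lower bound on a critical energy response beyond GKS `≥ 0` is known (`ν < 2/3`-type input).  The source sites
are excluded from `B_l`, so no `isingCorr` junk term (frozen spins outside `Λ∖{u}`) enters. -/
theorem stub_bulkResponseFloor :
    ∃ c₁ : ℝ, 0 < c₁ ∧ ∀ l : ℕ, 1 ≤ l → ∃ N₀ : ℕ, ∀ N : ℕ, N₀ ≤ N → ∀ a : Fin 4 → ↥(box 3 N),
      (∀ i, ((a i : Site 3)) = (l : ℤ) •
        (![![-1, -1, -1], ![1, 1, -1], ![1, -1, 1], ![-1, 1, 1]] : Fin 4 → Site 3) i) →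
      c₁ * isingCorr ((zdGraph 3).comap (Subtype.val : ↥(box 3 N) → Site 3)) Finset.univ
            (criticalBeta 3) 0 .free {a 2, a 3} *
          isingCorr ((zdGraph 3).comap (Subtype.val : ↥(box 3 N) → Site 3)) Finset.univ
            (criticalBeta 3) 0 .free {a 0, a 1}
        ≤ ∑ u ∈ (Finset.univ : Finset ↥(box 3 N)).filter
              (fun u : ↥(box 3 N) => (∀ i, |(u : Site 3) i| ≤ 2 * (l : ℤ)) ∧ u ∉ Finset.univ.image a),
            isingCorr ((zdGraph 3).comap (Subtype.val : ↥(box 3 N) → Site 3)) Finset.univ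
                (criticalBeta 3) 0 .free {a 2, u} *
              isingCorr ((zdGraph 3).comap (Subtype.val : ↥(box 3 N) → Site 3)) Finset.univ
                (criticalBeta 3) 0 .free {u, a 3} *
              (isingCorr ((zdGraph 3).comap (Subtype.val : ↥(box 3 N) → Site 3)) Finset.univ
                  (criticalBeta 3) 0 .free {a 0, a 1} -
                isingCorr ((zdGraph 3).comap (Subtype.val : ↥(box 3 N) → Site 3)) (Finset.univ.erase u)
                  (criticalBeta 3) 0 .free {a 0, a 1}) := by
  sorry

/-- **Stub 5 (mass concentration; OPEN, M/L).**  From Stubs 3 and 4 the additive deficit mass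
`X(C⁺) := Σ_{u ∈ C⁺ ∩ B_l} δ_u/⟨σ_{a₀}σ_{a₁}⟩` has first moment
`E^{ℓ^{23}⊗ℓ^∅} X(C⁺) = Σ_{u ∈ B_l} P[u ∈ C⁺] δ_u/⟨σσ⟩ ≥ c₀ Σ_{u ∈ B_l} (ττ/τ) δ_u/⟨σσ⟩ ≥ c₀ c₁` (a NECESSARY
condition for the conclusion: `E X ≥ ε p`).  The stub upgrades it to `P[X(C⁺) ≥ ε] ≥ p` (`MassPositive`,
cleared denominators).  Content: upper-tail control of `X(C⁺)` at its TRUE scale (prediction `X ≍ l^{0.55}`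
typically): two-point function of `C⁺` ≤ that of the double-current cluster `𝐂(a₂)`, for which ADC2021 App.
Prop. 8.3 (arXiv: A.3) gives `P[u,v ∈ 𝐂] ≤ (τ(a₂v)τ(vu)τ(ua₃) + τ(a₂u)τ(uv)τ(va₃))/τ(a₂a₃)` (two-step walk bound),
`δ_u ≤` AF86 Lemma 5.5 (`thetaCorr_singleton_sub_corrIn_le`, tree), regular scales (ADC2021 §5 /
Duminil-Copin–Panis 2025) — or a direct argument avoiding matched asymptotics.  Why it might fail: as an
implication it fails only if `MassPositive` does (the hole's deficit mass carried by an event of vanishing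
probability while its mean stays `≥ c₀c₁`) — not expected for a connected critical cluster containing `a₂,a₃`. -/
theorem stub_massConcentration :
    (∃ c₀ : ℝ, 0 < c₀ ∧ ∀ l : ℕ, 1 ≤ l → ∃ N₀ : ℕ, ∀ N : ℕ, N₀ ≤ N → ∀ a : Fin 4 → ↥(box 3 N),
      (∀ i, ((a i : Site 3)) = (l : ℤ) •
        (![![-1, -1, -1], ![1, 1, -1], ![1, -1, 1], ![-1, 1, 1]] : Fin 4 → Site 3) i) →
      ∀ u : ↥(box 3 N), (∀ i, |(u : Site 3) i| ≤ 2 * (l : ℤ)) → u ∉ Finset.univ.image a →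
      c₀ * loopO1PartitionFunction ((zdGraph 3).comap (Subtype.val : ↥(box 3 N) → Site 3))
            (Real.tanh (criticalBeta 3)) {a 2, u} *
          loopO1PartitionFunction ((zdGraph 3).comap (Subtype.val : ↥(box 3 N) → Site 3))
            (Real.tanh (criticalBeta 3)) {u, a 3}
        ≤ ∑ F₂ ∈ tJoins ((zdGraph 3).comap (Subtype.val : ↥(box 3 N) → Site 3)) Set.univ {a 2, a 3},
            ∑ F₀ ∈ tJoins ((zdGraph 3).comap (Subtype.val : ↥(box 3 N) → Site 3)) Set.univ (∅ : Finset ↥(box 3 N)),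
              if (SimpleGraph.fromEdgeSet ((↑F₂ : Set (Sym2 ↥(box 3 N))) ∪ ↑F₀)).Reachable (a 2) u
              then Real.tanh (criticalBeta 3) ^ (F₂.card + F₀.card) else 0) →
    (∃ c₁ : ℝ, 0 < c₁ ∧ ∀ l : ℕ, 1 ≤ l → ∃ N₀ : ℕ, ∀ N : ℕ, N₀ ≤ N → ∀ a : Fin 4 → ↥(box 3 N),
      (∀ i, ((a i : Site 3)) = (l : ℤ) •
        (![![-1, -1, -1], ![1, 1, -1], ![1, -1, 1], ![-1, 1, 1]] : Fin 4 → Site 3) i) →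
      c₁ * isingCorr ((zdGraph 3).comap (Subtype.val : ↥(box 3 N) → Site 3)) Finset.univ
            (criticalBeta 3) 0 .free {a 2, a 3} *
          isingCorr ((zdGraph 3).comap (Subtype.val : ↥(box 3 N) → Site 3)) Finset.univ
            (criticalBeta 3) 0 .free {a 0, a 1}
        ≤ ∑ u ∈ (Finset.univ : Finset ↥(box 3 N)).filter
              (fun u : ↥(box 3 N) => (∀ i, |(u : Site 3) i| ≤ 2 * (l : ℤ)) ∧ u ∉ Finset.univ.image a),
            isingCorr ((zdGraph 3).comap (Subtype.val : ↥(box 3 N) → Site 3)) Finset.univ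
                (criticalBeta 3) 0 .free {a 2, u} *
              isingCorr ((zdGraph 3).comap (Subtype.val : ↥(box 3 N) → Site 3)) Finset.univ
                (criticalBeta 3) 0 .free {u, a 3} *
              (isingCorr ((zdGraph 3).comap (Subtype.val : ↥(box 3 N) → Site 3)) Finset.univ
                  (criticalBeta 3) 0 .free {a 0, a 1} -
                isingCorr ((zdGraph 3).comap (Subtype.val : ↥(box 3 N) → Site 3)) (Finset.univ.erase u)
                  (criticalBeta 3) 0 .free {a 0, a 1})) →
    (∃ ε : ℝ, 0 < ε ∧ ∃ p : ℝ, 0 < p ∧ ∀ l : ℕ, 1 ≤ l → ∃ N₀ : ℕ, ∀ N : ℕ, N₀ ≤ N →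
      ∀ a : Fin 4 → ↥(box 3 N),
      (∀ i, ((a i : Site 3)) = (l : ℤ) •
        (![![-1, -1, -1], ![1, 1, -1], ![1, -1, 1], ![-1, 1, 1]] : Fin 4 → Site 3) i) →
      p * loopO1PartitionFunction ((zdGraph 3).comap (Subtype.val : ↥(box 3 N) → Site 3))
            (Real.tanh (criticalBeta 3)) {a 2, a 3} *
          loopO1PartitionFunction ((zdGraph 3).comap (Subtype.val : ↥(box 3 N) → Site 3))
            (Real.tanh (criticalBeta 3)) ∅
        ≤ ∑ F₂ ∈ tJoins ((zdGraph 3).comap (Subtype.val : ↥(box 3 N) → Site 3)) Set.univ {a 2, a 3},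
            ∑ F₀ ∈ tJoins ((zdGraph 3).comap (Subtype.val : ↥(box 3 N) → Site 3)) Set.univ (∅ : Finset ↥(box 3 N)),
              if ε * isingCorr ((zdGraph 3).comap (Subtype.val : ↥(box 3 N) → Site 3)) Finset.univ
                    (criticalBeta 3) 0 .free {a 0, a 1}
                  ≤ ∑ u ∈ (Finset.univ : Finset ↥(box 3 N)).filter
                      (fun u : ↥(box 3 N) => (∀ i, |(u : Site 3) i| ≤ 2 * (l : ℤ)) ∧ u ∉ Finset.univ.image a ∧
                        (SimpleGraph.fromEdgeSet ((↑F₂ : Set (Sym2 ↥(box 3 N))) ∪ ↑F₀)).Reachable (a 2) u),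
                      (isingCorr ((zdGraph 3).comap (Subtype.val : ↥(box 3 N) → Site 3)) Finset.univ
                          (criticalBeta 3) 0 .free {a 0, a 1} -
                        isingCorr ((zdGraph 3).comap (Subtype.val : ↥(box 3 N) → Site 3)) (Finset.univ.erase u)
                          (criticalBeta 3) 0 .free {a 0, a 1})
              then Real.tanh (criticalBeta 3) ^ (F₂.card + F₀.card) else 0) := by
  sorry

/-- **Stub 6 (shadow compounding; OPEN, L — the hardest).**  `MassPositive → UnionShadowDeficit`: if the
union cluster `C⁺` of `a₂` (under `ℓ^{a₂a₃} ⊗ ℓ^∅`, critical free box) carries additive deficit mass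
`X(C⁺) ≥ ε` with probability `≥ p`, then its expected shadow on `⟨σ_{a₀}σ_{a₁}⟩` is `≥ c = c(ε,p)`, uniformly
in `l`.  On the event, it suffices that the REALISED hole `S = V(C⁺)` satisfy
`1 - ⟨σ_{a₀}σ_{a₁}⟩_{Λ∖S}/⟨σ_{a₀}σ_{a₁}⟩_Λ ≥ c' · min(1, X(S))` (compounding of single-site deficits:
`log`-derivative `β Σ_{e ∼ S} ⟨σσ;σ_e⟩_s/⟨σσ⟩_s ≥ 0` along the coupling interpolation, GKS II); the junk
event `{a₀ ∈ C⁺ or a₁ ∈ C⁺}` only helps (it is part of the joining probability).  WARNING (why it might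
fail, and why the geometry of `C⁺` must enter): for ARBITRARY site sets the deterministic analogue is FALSE —
a set confined to a ball `B_r`, `r = l^{0.9}`, can have `X ≥ ε` while its shadow is `≤` that of the full
ball `≍ (r/l)^{Δ_ε} → 0` (GKS II monotonicity in the deleted set; screening) — so the proof must use that
`C⁺ ∋ a₂, a₃` is spread over scale `l` (it contains an `a₂–a₃` strand) and is sparse (dimension `≈ 2 - η < 3`);
relevance margin of such a defect for the `σσ` channel: `(2-η) - Δ_ε = 0.55 > 0` (`= 0`, logarithmic, in
`d = 4`; `< 0` in `d ≥ 5` and for the `α < 3/2` long-range models — the barrier regimes, where the stub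
fails as it must).  The conclusion is crux-equivalent (Stubs 1–2 and their provable converse), so this stub
carries the `d = 3` decision. -/
theorem stub_shadowCompounding :
    (∃ ε : ℝ, 0 < ε ∧ ∃ p : ℝ, 0 < p ∧ ∀ l : ℕ, 1 ≤ l → ∃ N₀ : ℕ, ∀ N : ℕ, N₀ ≤ N →
      ∀ a : Fin 4 → ↥(box 3 N),
      (∀ i, ((a i : Site 3)) = (l : ℤ) •
        (![![-1, -1, -1], ![1, 1, -1], ![1, -1, 1], ![-1, 1, 1]] : Fin 4 → Site 3) i) →
      p * loopO1PartitionFunction ((zdGraph 3).comap (Subtype.val : ↥(box 3 N) → Site 3))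
            (Real.tanh (criticalBeta 3)) {a 2, a 3} *
          loopO1PartitionFunction ((zdGraph 3).comap (Subtype.val : ↥(box 3 N) → Site 3))
            (Real.tanh (criticalBeta 3)) ∅
        ≤ ∑ F₂ ∈ tJoins ((zdGraph 3).comap (Subtype.val : ↥(box 3 N) → Site 3)) Set.univ {a 2, a 3},
            ∑ F₀ ∈ tJoins ((zdGraph 3).comap (Subtype.val : ↥(box 3 N) → Site 3)) Set.univ (∅ : Finset ↥(box 3 N)),
              if ε * isingCorr ((zdGraph 3).comap (Subtype.val : ↥(box 3 N) → Site 3)) Finset.univ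
                    (criticalBeta 3) 0 .free {a 0, a 1}
                  ≤ ∑ u ∈ (Finset.univ : Finset ↥(box 3 N)).filter
                      (fun u : ↥(box 3 N) => (∀ i, |(u : Site 3) i| ≤ 2 * (l : ℤ)) ∧ u ∉ Finset.univ.image a ∧
                        (SimpleGraph.fromEdgeSet ((↑F₂ : Set (Sym2 ↥(box 3 N))) ∪ ↑F₀)).Reachable (a 2) u),
                      (isingCorr ((zdGraph 3).comap (Subtype.val : ↥(box 3 N) → Site 3)) Finset.univ
                          (criticalBeta 3) 0 .free {a 0, a 1} -
                        isingCorr ((zdGraph 3).comap (Subtype.val : ↥(box 3 N) → Site 3)) (Finset.univ.erase u)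
                          (criticalBeta 3) 0 .free {a 0, a 1})
              then Real.tanh (criticalBeta 3) ^ (F₂.card + F₀.card) else 0) →
    (∃ c : ℝ, 0 < c ∧ ∀ l : ℕ, 1 ≤ l → ∃ N₀ : ℕ, ∀ N : ℕ, N₀ ≤ N → ∀ a : Fin 4 → ↥(box 3 N),
      (∀ i, ((a i : Site 3)) = (l : ℤ) •
        (![![-1, -1, -1], ![1, 1, -1], ![1, -1, 1], ![-1, 1, 1]] : Fin 4 → Site 3) i) →
      (∑ F₂ ∈ tJoins ((zdGraph 3).comap (Subtype.val : ↥(box 3 N) → Site 3)) Set.univ {a 2, a 3},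
        ∑ F₀ ∈ tJoins ((zdGraph 3).comap (Subtype.val : ↥(box 3 N) → Site 3)) Set.univ (∅ : Finset ↥(box 3 N)),
          if ¬ (SimpleGraph.fromEdgeSet ((↑F₂ : Set (Sym2 ↥(box 3 N))) ∪ ↑F₀)).Reachable (a 2) (a 0) ∧
             ¬ (SimpleGraph.fromEdgeSet ((↑F₂ : Set (Sym2 ↥(box 3 N))) ∪ ↑F₀)).Reachable (a 2) (a 1)
          then Real.tanh (criticalBeta 3) ^ (F₂.card + F₀.card) *
               isingCorr ((zdGraph 3).comap (Subtype.val : ↥(box 3 N) → Site 3))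
                 (Finset.univ.filter (fun v : ↥(box 3 N) =>
                   ¬ (SimpleGraph.fromEdgeSet ((↑F₂ : Set (Sym2 ↥(box 3 N))) ∪ ↑F₀)).Reachable (a 2) v))
                 (criticalBeta 3) 0 .free {a 0, a 1}
          else 0)
        ≤ (1 - c) * (loopO1PartitionFunction ((zdGraph 3).comap (Subtype.val : ↥(box 3 N) → Site 3))
                (Real.tanh (criticalBeta 3)) {a 2, a 3} *
              loopO1PartitionFunction ((zdGraph 3).comap (Subtype.val : ↥(box 3 N) → Site 3))
                (Real.tanh (criticalBeta 3)) ∅ *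
              isingCorr ((zdGraph 3).comap (Subtype.val : ↥(box 3 N) → Site 3)) Finset.univ
                (criticalBeta 3) 0 .free {a 0, a 1})) := by
  sorry

/-! ### The composition (lead -1): exactly the FOUR open stubs imply the crux, BY NAME -/

/-- **The line closes the crux modulo its four open stubs** (3 one-point attachment, 4 bulk response floor,
5 concentration, 6 compounding); stubs 1–2 are the LANDED `stub_unionShadowIdentity` / `stub_shadowGivesCrux` above. -/
theorem IndependentStrandsJoin_of (h3 : Registered.stub_unionAttach)
    (h4 : Registered.stub_bulkResponseFloor) (h5 : Registered.stub_massConcentration)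
    (h6 : Registered.stub_shadowCompounding) : IndependentStrandsJoin :=
  IndependentStrandsJoin_of_six stub_unionShadowIdentity stub_shadowGivesCrux h3 h4 h5 h6

/-! ### Consistency: each registered stub IS its name-keyed alias (definitionally), and the wiring -/

example : Registered.stub_unionShadowIdentity := stub_unionShadowIdentity
example : Registered.stub_shadowGivesCrux := stub_shadowGivesCrux
example : Registered.stub_unionAttach := stub_unionAttach
example : Registered.stub_bulkResponseFloor := stub_bulkResponseFloor
example : Registered.stub_massConcentration := stub_massConcentration
example : Registered.stub_shadowCompounding := stub_shadowCompounding
example : CruxBody ↔ IndependentStrandsJoin := Iff.rfl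

/-- CONVERSE (landed `Theorems.stub_shadowConverse`): over the identity, the crux gives back `UnionShadowDeficit` with the
same constant — the line's content beyond stubs 1–2 is crux-EQUIVALENT. -/
example (h : IndependentStrandsJoin) : UnionShadowDeficit := by
  have hI' := fun (V : Type) [Fintype V] [DecidableEq V] (G : SimpleGraph V) [DecidableRel G.Adj] (β : ℝ)
      (hβ : 0 ≤ β) (a : Fin 4 → V) (ha : Function.Injective a) =>
    Summit.CriticalPhenomena.Ising3DConformalLimit.Theorems.stub_unionShadowIdentity V G β hβ a ha
  have hc : CruxBody := h
  have h' := Summit.CriticalPhenomena.Ising3DConformalLimit.Theorems.stub_shadowConverse hI' (by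
    convert hc
    (constructor <;> rintro ⟨c, hc, hh⟩ <;> refine ⟨c, hc, fun l hl => ?_⟩ <;> obtain ⟨N₀, hh⟩ := hh l hl <;>
      refine ⟨N₀, fun N hN a ha => ?_⟩ <;> have h2 := hh N hN a ha <;> (try dsimp only at h2 ⊢) <;> convert h2 using 8))
  convert h'
  (constructor <;> rintro ⟨c, hc, hh⟩ <;> refine ⟨c, hc, fun l hl => ?_⟩ <;> obtain ⟨N₀, hh⟩ := hh l hl <;>
      refine ⟨N₀, fun N hN a ha => ?_⟩ <;> have h2 := hh N hN a ha <;> convert h2 using 8)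

/-- Wiring check: the registered stubs feed `IndependentStrandsJoin_of` as stated. -/
example : IndependentStrandsJoin :=
  IndependentStrandsJoin_of stub_unionAttach stub_bulkResponseFloor stub_massConcentration stub_shadowCompounding

/-! ### Negative lemmas this stub set is checked against (landed, imported) -/

/-- The GRAPH-UNIFORM strengthening of the crux is refuted in tree (`Negative/GraphUniform.lean`): every
constant-bearing stub above (3–6) is stated on the boxes `Λ_N ⊂ ℤ³` at `t_c` only. -/
example : ¬ ∃ c : ℝ, 0 < c ∧ ∀ (V : Type) [Fintype V] [DecidableEq V] (G : SimpleGraph V) [DecidableRel G.Adj]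
      (a : Fin 4 → V), Function.Injective a →
      (let t : ℝ := Real.tanh (criticalBeta 3);
       c * loopO1PartitionFunction G t {a 0, a 1} * loopO1PartitionFunction G t {a 2, a 3} ≤
        ∑ F₁ ∈ tJoins G Set.univ {a 0, a 1}, ∑ F₂ ∈ tJoins G Set.univ {a 2, a 3},
          if (SimpleGraph.fromEdgeSet ((↑F₁ : Set (Sym2 V)) ∪ ↑F₂)).Reachable (a 0) (a 2)
            then t ^ (#F₁ + #F₂) else 0) :=
  Summit.CriticalPhenomena.Ising3DConformalLimit.IndependentStrandsJoinNegative.not_graphUniformStrandsJoin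

-- `1 ≤ l` is not load-bearing and the crux implies its per-scale form (`Negative/LoadBearing.lean`,
-- `independentStrandsJoin_perScale`, landed p91361; not imported here while its farm olean is pending):
-- the content of every open stub above is the `l`-UNIFORMITY of its constant (`∃ c` before `∀ l`).

end Summit.CriticalPhenomena.Ising3DConformalLimit.Cruxes.IndependentStrandsJoin.UnionShadowExact

end
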